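import Literature.NumberTheory.LFunctions.Zhang2022.DetectorShiftDoubledParseval
import Literature.NumberTheory.LFunctions.Zhang2022.DetectorDoublingIdentity
import Literature.NumberTheory.LFunctions.Zhang2022.DetectorConeFinOne

/-!
# [K6] The DOUBLING route composed: `FormDetPSD (shiftRecipe b)` for every sign-admissible triple,
# hence E-102 HEAD 2 `Det.MonomialConePSD (Set.Ioo 0 5)` (and the box-free form)

E-102 kernel plan of record (ls-barrier-plan g1 2026-08-27T01:45:23Z «DOUBLING», theory g2 referee PASS 01:41:40Z,
re-stamped EXACT 01:53:59Z): for a one-sided kinked profile `g` on `[0,1]` and a sign-admissible triple `b`,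

* [K1] (tree, `DetectorShiftClosedForm`, ls-barrier-p2 g3) `(π/2)·𝔅_{shiftRecipe b}(g) = c₀(b)·T_b^{[0,1]}(S_g) + F_b(x(g))`
  with `S_g = tailPrim g`, `c₀ = Re Σ_j W_j`, `T_b = Det.bulkFormOn b`, `F_b = Det.freeEndForm b`, `x(g) = (∫₀¹ g, −g(0))`;
* [K2] (`DetectorDoublingIdentity`, ls-barrier-p5 g3) for every datum `x` an explicit exponential extremal `F⋆_x` on `[0,1]`,
  clamped at `0`, with jet `x` at `1` and `c₀·T_b^{[0,1]}(F⋆_x) = F_b(x)` (the doubling identity D1, barrier-num g2);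
* [K3] (tree, `DetectorShiftDoubledParseval`, ls-Bmulti-typer-2 g3) for two `C¹`-matching pieces clamped at `∓1`,
  `T^{[−1,0]}(S_L) + T^{[0,1]}(S_R) = 2π⁴ Σ_{m∈ℤ} p_b(m)|ĉ_m|² ≥ 0` as soon as `p_b(m) = Det.bulkSymbol b m ≥ 0` on `ℤ`;
* [K4] (tree, `SignAdmissible.bulkSymbol_intCast_nonneg`) the lattice inequality; [K5] (tree, `Det.re_sum_shiftW_pos`) `c₀ > 0`.

[K6] (this file) glues: translate `F⋆_{x(g)}` to `[−1,0]` (`y ↦ y + 1`), pair it with `S_g` (their jets match at `0` by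
construction), and read `(π/2)·𝔅(g) = c₀·[T^{[−1,0]}(F⋆) + T^{[0,1]}(S_g)] ≥ 0`.

Main results: `Det.formDetPSD_shiftRecipe_of_leftPieces` (the composition with [K2] displayed as an explicit existence
hypothesis in the periodic orientation — the interface, v1) and, with [K2] from the tree (Part 3, v2),
`Det.formDetPSD_shiftRecipe_of_signAdmissible`, `Det.monomialConePSD_unit : MonomialConePSD (Set.Ioo 0 5)` (E-102 HEAD 2),
`Det.monomialConePSD_all`, `Det.edetPremise_unit_iff_edetCone`, `Det.conePSD_fin_one_unit`.
0 named facts, 0 sorries. The programme SEARCHES and TYPES; no claim about Landau–Siegel zeros, Theorems 1–2 of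
arXiv:2211.02515 or a repaired (2.32) margin is made here.
-/

noncomputable section

open Complex Real ComplexConjugate Set MeasureTheory intervalIntegral Topology Filter

namespace Literature.NumberTheory.LFunctions.Zhang2022

namespace Det

open Repair

variable {b : Fin 3 → ℝ} {g g' : ℝ → ℂ}

/-! ### Part 1 — orientation bookkeeping: a piece on `[0,1]` read on `[−1,0]` through `y ↦ y + 1` -/

/-- Translation of the bulk form: `T_b^{[−1,0]}(S(·+1)) = T_b^{[0,1]}(S)`.
[cite: Zhang2022LandauSiegel, Prop 7.1 p.44 with (7.2), (8.11)–(8.23)] -/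
theorem bulkFormOn_comp_add_one (b : Fin 3 → ℝ) (S S' S'' : ℝ → ℂ) :
    bulkFormOn b (-1) 0 (fun y => S (y + 1)) (fun y => S' (y + 1)) (fun y => S'' (y + 1))
      = bulkFormOn b 0 1 S S' S'' := by
  unfold bulkFormOn
  rw [intervalIntegral.integral_comp_add_right (fun y => (‖S'' y‖ ^ 2 + π * (b 0 + b 1 + b 2) * (S'' y * conj (S' y)).im
    + π ^ 2 * (b 0 * b 1 + b 1 * b 2 + b 2 * b 0) * ‖S' y‖ ^ 2
    + π ^ 3 * (b 0 * b 1 * b 2) * (S' y * conj (S y)).im)) (1:ℝ)]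
  norm_num

/-- Continuity transported along `y ↦ y + 1`. [folklore] -/
private theorem continuousOn_comp_add_one {F : ℝ → ℂ} (hF : ContinuousOn F (Icc 0 1)) :
    ContinuousOn (fun y => F (y + 1)) (Icc (-1) 0) := by
  refine hF.comp (continuous_id.add continuous_const).continuousOn fun y hy => ?_
  exact ⟨by linarith [hy.1], by linarith [hy.2]⟩

/-- Right-derivatives transported along `y ↦ y + 1`. [folklore] -/
private theorem hasDerivWithinAt_comp_add_one {F F' : ℝ → ℂ}
    (hF : ∀ y ∈ Ioo (0:ℝ) 1, HasDerivWithinAt F (F' y) (Ioi y) y) {y : ℝ} (hy : y ∈ Ioo (-1:ℝ) 0) :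
    HasDerivWithinAt (fun y => F (y + 1)) (F' (y + 1)) (Ioi y) y := by
  have hy' : y + 1 ∈ Ioo (0:ℝ) 1 := ⟨by linarith [hy.1], by linarith [hy.2]⟩
  have h := hF (y + 1) hy'
  have h2 : HasDerivWithinAt (fun t : ℝ => t + 1) (1:ℝ) (Ioi y) y := (hasDerivAt_id y).add_const 1 |>.hasDerivWithinAt
  have := h.scomp y h2 (fun t ht => by simpa using ht)
  rw [Function.comp_def] at this
  simpa using this

/-! ### Part 2 — the composition with the left piece displayed (interface form of [K2]) -/

/-- **[K6] interface form.** If for the datum `x(g) = (∫₀¹ g, −g(0))` of a one-sided kinked `g` there is a left piece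
`F` on `[0,1]` (periodic orientation: clamped at `0`, jet `x(g)` at `1`, continuous with right-derivatives `F′`, `F″` on
the open piece) with `c₀(b)·T_b^{[0,1]}(F) = F_b(x(g))`, then `𝔅_{shiftRecipe b}(g) ≥ 0` ([K1] + [K3] + [K4] + [K5]).
[cite: Zhang2022LandauSiegel, Prop 7.1 p.44 with (7.2), (8.11)–(8.23)] -/
theorem formDet_shiftRecipe_nonneg_of_leftPiece (hb : SignAdmissible b) (hg : KinkedProfile g g') (hg1 : g 1 = 0)
    {F F' F'' : ℝ → ℂ} (hc : ContinuousOn F (Icc 0 1)) (hc' : ContinuousOn F' (Icc 0 1))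
    (hc'' : ContinuousOn F'' (Icc 0 1))
    (hd : ∀ y ∈ Ioo (0:ℝ) 1, HasDerivWithinAt F (F' y) (Ioi y) y)
    (hd' : ∀ y ∈ Ioo (0:ℝ) 1, HasDerivWithinAt F' (F'' y) (Ioi y) y)
    (h0 : F 0 = 0) (h0' : F' 0 = 0) (h1 : F 1 = ∫ y in (0:ℝ)..1, g y) (h1' : F' 1 = -g 0)
    (hid : (∑ j : Fin 3, shiftW b j).re * bulkFormOn b 0 1 F F' F''
      = freeEndForm b (∫ y in (0:ℝ)..1, g y) (-g 0)) :
    0 ≤ FormDet (shiftRecipe b) g g' := by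
  obtain ⟨hRc, hRc', hRd, hRd', hRmem, hR1, hR1'⟩ := rightPiece_of_kinked hg hg1
  have hsum := bulkFormOn_two_piece_nonneg_of_signAdmissible hb (continuousOn_comp_add_one hc)
    (continuousOn_comp_add_one hc') (fun y hy => hasDerivWithinAt_comp_add_one hd hy)
    (fun y hy => hasDerivWithinAt_comp_add_one hd' hy) (memLp_two_of_continuousOn_Icc' (continuousOn_comp_add_one hc''))
    hRc hRc' hRd hRd' hRmem (by simpa using h0) (by simpa using h0') hR1 hR1'
    (by simp [h1, tailPrim_zero]) (by simp [h1'])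
  rw [bulkFormOn_comp_add_one] at hsum
  have hc0 : 0 < (∑ j : Fin 3, shiftW b j).re := re_sum_shiftW_pos hb
  have hK1 := formDet_shiftRecipe_eq_bulk_add_freeEnd hb.injective hg hg1
  rw [← hid] at hK1
  have hπ : 0 < π / 2 := by positivity
  have key : π / 2 * FormDet (shiftRecipe b) g g'
      = (∑ j : Fin 3, shiftW b j).re * (bulkFormOn b 0 1 F F' F''
          + bulkFormOn b 0 1 (tailPrim g) (fun y => -g y) (fun y => -g' y)) := by
    rw [hK1]; ring
  nlinarith [mul_nonneg hc0.le hsum, key]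

/-- **[K6] interface form, as `FormDetPSD`:** existence of the left piece for every datum `(x₁, x₂)` gives
`FormDetPSD (shiftRecipe b)`. [cite: Zhang2022LandauSiegel, Prop 7.1 p.44 with (7.2), (8.11)–(8.23)] -/
theorem formDetPSD_shiftRecipe_of_leftPieces (hb : SignAdmissible b)
    (hK2 : ∀ x₁ x₂ : ℂ, ∃ F F' F'' : ℝ → ℂ,
      ContinuousOn F (Icc 0 1) ∧ ContinuousOn F' (Icc 0 1) ∧ ContinuousOn F'' (Icc 0 1) ∧
      (∀ y ∈ Ioo (0:ℝ) 1, HasDerivWithinAt F (F' y) (Ioi y) y) ∧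
      (∀ y ∈ Ioo (0:ℝ) 1, HasDerivWithinAt F' (F'' y) (Ioi y) y) ∧
      F 0 = 0 ∧ F' 0 = 0 ∧ F 1 = x₁ ∧ F' 1 = x₂ ∧
      (∑ j : Fin 3, shiftW b j).re * bulkFormOn b 0 1 F F' F'' = freeEndForm b x₁ x₂) :
    FormDetPSD (shiftRecipe b) := by
  intro g g' hg hg1
  obtain ⟨F, F', F'', hc, hc', hc'', hd, hd', h0, h0', h1, h1', hid⟩ := hK2 (∫ y in (0:ℝ)..1, g y) (-g 0)
  exact formDet_shiftRecipe_nonneg_of_leftPiece hb hg hg1 hc hc' hc'' hd hd' h0 h0' h1 h1' hid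

/-! ### Part 3 (v2) — THE CONCLUSION: [K2] from the tree (ls-barrier-p5 g3's `DetectorDoublingIdentity`,
`Det.doublingIdentity_clamped_of_re_ne_zero`) instantiates Part 2 ⇒ `FormDetPSD (shiftRecipe b)` for every sign-admissible
`b`; E-102 HEAD 2 `Det.MonomialConePSD (Set.Ioo 0 5)` and the box-free form -/

section Conclusion

/-- **[K1–K6] `FormDetPSD (shiftRecipe b)` for EVERY sign-admissible triple `b`** — Zhang's one-sided `|S| = 3`
detector slot (registry E-010 / E-102 head 2) is non-negative on all one-sided kinked profiles: the left piece is
ls-barrier-p5 g3's clamped exponential extremal `F⋆_x` (`DetectorDoublingClamped` / `DetectorDoublingIdentity`: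
boundary data `clampedExt_boundary_of_re_ne_zero`, derivatives `hasDerivAt_extremal/…D/…DD`, and the doubling identity
`doublingIdentity_clamped_of_re_ne_zero`), fed to Part 2. [cite: Zhang2022LandauSiegel, Prop 7.1 p.44 with (7.2), (8.11)–(8.23)] -/
theorem formDetPSD_shiftRecipe_of_signAdmissible (hb : SignAdmissible b) : FormDetPSD (shiftRecipe b) := by
  have hinj := hb.injective
  have h01 : b 0 ≠ b 1 := fun h => absurd (hinj h) (by decide)
  have h02 : b 0 ≠ b 2 := fun h => absurd (hinj h) (by decide)
  have h12 : b 1 ≠ b 2 := fun h => absurd (hinj h) (by decide)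
  have hc : (atomA0 b).re ≠ 0 := by unfold atomA0; exact (re_sum_shiftW_pos hb).ne'
  refine formDetPSD_shiftRecipe_of_leftPieces hb fun x₁ x₂ => ?_
  obtain ⟨h0, h0', h1, h1'⟩ := clampedExt_boundary_of_re_ne_zero b x₁ x₂ h01 h02 h12 hc
  set γ := clampedCoeff b x₁ x₂
  refine ⟨extremal b γ, extremalD b γ, extremalDD b γ,
    fun t _ => (hasDerivAt_extremal b γ t).continuousAt.continuousWithinAt,
    fun t _ => (hasDerivAt_extremalD b γ t).continuousAt.continuousWithinAt,
    fun t _ => (hasDerivAt_extremalDD b γ t).continuousAt.continuousWithinAt,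
    fun y _ => (hasDerivAt_extremal b γ y).hasDerivWithinAt,
    fun y _ => (hasDerivAt_extremalD b γ y).hasDerivWithinAt, h0, h0', h1, h1', ?_⟩
  have h := doublingIdentity_clamped_of_re_ne_zero b x₁ x₂ h01 h02 h12 hc
  unfold atomA0 at h
  exact h

/-- **E-102 HEAD 2 (decl of record `Det.EdetPremise`, p476440): `Det.MonomialConePSD (Set.Ioo 0 5)`.**
[cite: Zhang2022LandauSiegel, Prop 7.1 p.44 with (7.2), (8.11)–(8.23)] -/
theorem monomialConePSD_unit : MonomialConePSD (Set.Ioo 0 5) := fun _ hb _ =>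
  formDetPSD_shiftRecipe_of_signAdmissible hb

/-- Box-free form: `Det.MonomialConePSD B` for every box `B` (the box hypothesis is not used).
[cite: Zhang2022LandauSiegel, Prop 7.1 p.44 with (7.2), (8.11)–(8.23)] -/
theorem monomialConePSD_all (B : Set ℝ) : MonomialConePSD B := fun _ hb _ =>
  formDetPSD_shiftRecipe_of_signAdmissible hb

/-- `MonomialConePSD` holds for all parameters — `_holds` alias of `monomialConePSD_all` above under the fact's exact name
(appended 2026-08-28, D-0026 bookkeeping: the proof term is the existing theorem of this file; no statement,
definition or attribute is edited; no new named fact; the ledger's debt table listed the fact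
unproved). [cite: Zhang2022LandauSiegel, Prop 7.1 p.44 with (7.2), (8.11)–(8.23)] -/
theorem _root_.Literature.NumberTheory.LFunctions.Zhang2022.Det.MonomialConePSD_holds (B : Set ℝ) :
    MonomialConePSD B :=
  _root_.Literature.NumberTheory.LFunctions.Zhang2022.Det.monomialConePSD_all B

/-- After head 2, the E-102 premise in the unit box IS its head 1 (the entangled cone `Det.EdetCone`; its `K = 1`
members follow from head 2 by `Det.edetCone_fin_one_of_monomialConePSD`, its `K = 2` members are the cross-profile
Cauchy–Schwarz inequalities `Det.conePSD_pair_iff`). [cite: Zhang2022LandauSiegel, Prop 7.1 p.44 with (7.2)] -/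
theorem edetPremise_unit_iff_edetCone :
    EdetPremise (Set.Ioo 0 1) (Set.Ioo 0 5) ↔ EdetCone (Set.Ioo 0 1) (Set.Ioo 0 5) :=
  ⟨fun h => h.1, fun h => ⟨h, monomialConePSD_unit⟩⟩

/-- Head 1 on every single-node palette of the unit box, now unconditional.
[cite: Zhang2022LandauSiegel, Prop 7.1 p.44 with (7.2), (7.19)–(7.21)] -/
theorem conePSD_fin_one_unit {a x : ℝ} (ha : a ∈ Set.Ioo (0:ℝ) 1) (hx : x ∈ Set.Ioo (0:ℝ) 5) : ConePSD a ![x] :=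
  conePSD_fin_one_of_monomialConePSD monomialConePSD_unit ha hx

end Conclusion

end Det

end Literature.NumberTheory.LFunctions.Zhang2022
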